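import Summits.KontsevichZagierPeriods.KontsevichZagierPeriods.Theses.FurushoPentagon
import Literature.NumberTheory.Transcendental.MZVSimplexRep

/-!
# `PentagonInKZ`, line `logfree-gauge-corner-flatness`: the fifteen path families exist

Stub `stub_pathFamilies` of the crux `PentagonInKZ` (stmt-KontsevichZagierPeriods-11348, route
FurushoPentagon).  Every path `p : Fin 15` of the atlas (ten half-edges and five legs of the closed
pentagon cell of `M₀,₅(ℝ)`) is read in a chart in which the KZ connection is
`Σ_{j : Fin 3} A_j dt/(t - σ_p j)` with rational pole positions `σ_p : Fin 3 → ℝ` (`![0,1,2]`,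
`![0,1,-1]` or `![0,-1,2]`), run from the tangential base point at `t = 0` to `t = β_p`
(`1/2`, resp. `1` for the paths `10, 11`).  For a word `w` over `Fin 3` NOT ending in the letter
`0` (the pole at `t = 0`) the iterated integral

`∫_{β_p > t₀ > ⋯ > t_{n-1} > 0} ∏ᵢ dtᵢ/(tᵢ - σ_p(wᵢ))` (leftmost letter outermost)

is an integral representation in the sense of Kontsevich–Zagier (`KZ.IntegralRep w.length`):

* the domain (an open ordered simplex of side `β_p ∈ ℚ`, `β_p ≤ 1`) is the part of the standard
  open ordered simplex below the level `β_p`, cut out by finitely many strict polynomial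
  inequalities over `ℚ`, hence `ℚ`-semialgebraic (`KZ.isSemialgebraic_openOrderedSimplex`);
* the integrand is the reciprocal of the polynomial `∏ᵢ (Xᵢ - σ_p(wᵢ)) ∈ ℚ[X]`, non-vanishing on
  the domain (the poles `1, 2, -1` stay at distance `≥ 1/2` from `(0, β_p)`, and `tᵢ > 0`), hence
  a `ℚ`-semialgebraic function (`isSemialgebraicFunOn_aeval_div_aeval`);
* ABSOLUTE INTEGRABILITY by domination (the argument of `KZ.integrableOn_prod_mzvForm`): on the
  domain every factor with pole `≠ 0` has modulus `≤ 2`, a factor with pole `0` is `tᵢ⁻¹` and does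
  not occur in the innermost position, so `KZ.prod_inv_le_prod_rpow` bounds the integrand by
  `2ⁿ ∏ᵢ tᵢ^{-c}`, `c = 1 - 1/n < 1`, a product of one-variable functions integrable on `(0, 1)`,
  integrable on the cube (Fubini, `MeasureTheory.Integrable.fintype_prod`).

Words ending in the letter `0` diverge and are never read by the skeleton; for them the
representation carries the (integrable, semialgebraic) integrand `0` on the same domain.
Everything is proved for a general side `β ≤ 1`, `β ∈ ℚ`, and a general row of rational poles
`σ : Fin 3 → ℝ` separated from `(0, β)` (`PathFamilies.exists_rep`); the two atlas tables of the
registered signature enter only through five finite checks (`fin_cases`).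

References: M. Kontsevich, D. Zagier, *Periods* (2001), §1.1; D. Zagier, *Values of zeta
functions and their applications* (1994), §9; V. G. Drinfeld (1991), §2.
-/

noncomputable section

open Set MeasureTheory MvPolynomial
open Literature.NumberTheory.Transcendental
open Literature.ModelTheory.ExponentialFields (IsSemialgebraic isSemialgebraic_setOf_eval_lt)

namespace Summit.KontsevichZagierPeriods.FurushoPentagon.PentagonInKZ

namespace PathFamilies

/-! ### The atlas tables: five finite checks -/

/-- Every endpoint `β_p` (`1/2`, or `1` for the paths `10, 11`) is rational. [folklore] -/
theorem bound_rat (p : Fin 15) : ∃ q : ℚ,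
    (![1/2, 1/2, 1/2, 1/2, 1/2, 1/2, 1/2, 1/2, 1/2, 1/2, 1, 1, 1/2, 1/2, 1/2] : Fin 15 → ℝ) p
      = q := by
  refine ⟨(![1/2, 1/2, 1/2, 1/2, 1/2, 1/2, 1/2, 1/2, 1/2, 1/2, 1, 1, 1/2, 1/2, 1/2] : Fin 15 → ℚ)
    p, ?_⟩
  fin_cases p <;> norm_num

/-- Every endpoint `β_p` is at most `1`. [folklore] -/
theorem bound_le_one (p : Fin 15) :
    (![1/2, 1/2, 1/2, 1/2, 1/2, 1/2, 1/2, 1/2, 1/2, 1/2, 1, 1, 1/2, 1/2, 1/2] : Fin 15 → ℝ) p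
      ≤ 1 := by
  fin_cases p <;> norm_num

/-- Every pole position `σ_p(j)` (`0`, `1`, `2` or `-1`) is rational. [folklore] -/
theorem shift_rat (p : Fin 15) (j : Fin 3) : ∃ q : ℚ,
    (![![0, 1, 2], ![0, 1, -1], ![0, 1, 2], ![0, 1, -1], ![0, 1, 2], ![0, 1, 2], ![0, 1, 2],
      ![0, 1, 2], ![0, 1, 2], ![0, 1, 2], ![0, -1, 2], ![0, -1, 2], ![0, 1, 2], ![0, 1, 2],
      ![0, 1, 2]] : Fin 15 → Fin 3 → ℝ) p j = q := by
  refine ⟨(![![0, 1, 2], ![0, 1, -1], ![0, 1, 2], ![0, 1, -1], ![0, 1, 2], ![0, 1, 2],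
    ![0, 1, 2], ![0, 1, 2], ![0, 1, 2], ![0, 1, 2], ![0, -1, 2], ![0, -1, 2], ![0, 1, 2],
    ![0, 1, 2], ![0, 1, 2]] : Fin 15 → Fin 3 → ℚ) p j, ?_⟩
  fin_cases p <;> fin_cases j <;> norm_num

/-- Only the letter `0` has its pole at `t = 0`. [folklore] -/
theorem shift_ne_zero (p : Fin 15) (j : Fin 3) (hj : j ≠ 0) :
    (![![0, 1, 2], ![0, 1, -1], ![0, 1, 2], ![0, 1, -1], ![0, 1, 2], ![0, 1, 2], ![0, 1, 2],
      ![0, 1, 2], ![0, 1, 2], ![0, 1, 2], ![0, -1, 2], ![0, -1, 2], ![0, 1, 2], ![0, 1, 2],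
      ![0, 1, 2]] : Fin 15 → Fin 3 → ℝ) p j ≠ 0 := by
  fin_cases p <;> fin_cases j <;> first
    | exact absurd rfl hj
    | norm_num

/-- **Separation of the regular poles.** Every letter either has its pole at `0`, or its pole
(at `1`, `2` or `-1`) stays at distance `≥ 1/2` from the open interval `(0, β_p)`. [folklore] -/
theorem shift_sep (p : Fin 15) (j : Fin 3) :
    (![![0, 1, 2], ![0, 1, -1], ![0, 1, 2], ![0, 1, -1], ![0, 1, 2], ![0, 1, 2], ![0, 1, 2],
      ![0, 1, 2], ![0, 1, 2], ![0, 1, 2], ![0, -1, 2], ![0, -1, 2], ![0, 1, 2], ![0, 1, 2],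
      ![0, 1, 2]] : Fin 15 → Fin 3 → ℝ) p j = 0 ∨
    ∀ x : ℝ, 0 < x →
      x < (![1/2, 1/2, 1/2, 1/2, 1/2, 1/2, 1/2, 1/2, 1/2, 1/2, 1, 1, 1/2, 1/2, 1/2] :
        Fin 15 → ℝ) p →
      2⁻¹ ≤ |x - (![![0, 1, 2], ![0, 1, -1], ![0, 1, 2], ![0, 1, -1], ![0, 1, 2], ![0, 1, 2],
        ![0, 1, 2], ![0, 1, 2], ![0, 1, 2], ![0, 1, 2], ![0, -1, 2], ![0, -1, 2], ![0, 1, 2],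
        ![0, 1, 2], ![0, 1, 2]] : Fin 15 → Fin 3 → ℝ) p j| := by
  fin_cases p <;> fin_cases j <;> norm_num <;> intro x h0 h1 <;>
    first
    | exact le_abs.2 (Or.inl (by linarith))
    | exact le_abs.2 (Or.inr (by linarith))

/-! ### Poles separated from `(0, β)` -/

/-- A factor `x - c` whose pole `c` is `0` or separated from `(0, β)` does not vanish for
`x ∈ (0, β)`. [folklore] -/
theorem sub_pole_ne_zero {β c x : ℝ} (hc : c = 0 ∨ ∀ x : ℝ, 0 < x → x < β → 2⁻¹ ≤ |x - c|)
    (h0 : 0 < x) (h1 : x < β) : x - c ≠ 0 := by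
  rcases hc with rfl | hc
  · rw [sub_zero]
    exact h0.ne'
  · intro h
    have := hc x h0 h1
    rw [h, abs_zero] at this
    norm_num at this

/-- **Letter bound** on `(0, β)`: a factor with pole `0` is `x⁻¹` in modulus, a factor with a
separated pole has modulus `≤ 2`; uniformly `|1/(x - c)| ≤ 2 · (if c = 0 then x⁻¹ else 1)`.
[folklore] -/
theorem abs_inv_sub_pole_le {β c x : ℝ} (hc : c = 0 ∨ ∀ x : ℝ, 0 < x → x < β → 2⁻¹ ≤ |x - c|)
    (h0 : 0 < x) (h1 : x < β) : |1 / (x - c)| ≤ 2 * (if c = 0 then x⁻¹ else 1) := by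
  split_ifs with h
  · subst h
    rw [sub_zero, one_div, abs_of_pos (inv_pos.2 h0)]
    linarith [inv_pos.2 h0]
  · rcases hc with hc | hc
    · exact absurd hc h
    · rw [mul_one, one_div, abs_inv]
      exact inv_le_of_inv_le₀ two_pos (hc x h0 h1)

/-! ### The simplices of side `β ≤ 1` -/

/-- For `β ≤ 1` the open ordered simplex `β > t₀ > ⋯ > t_{n-1} > 0` of side `β` is the part of
the standard open ordered simplex `1 > t₀ > ⋯ > t_{n-1} > 0` below the level `β`. [folklore] -/
theorem simplex_eq_inter {β : ℝ} (hβ : β ≤ 1) (n : ℕ) :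
    {t : Fin n → ℝ | (∀ i, 0 < t i ∧ t i < β) ∧ StrictAnti t} =
      {t | ∀ i, t i < β} ∩ KZ.openOrderedSimplex n := by
  ext t
  simp only [KZ.openOrderedSimplex, mem_setOf_eq, mem_inter_iff]
  constructor
  · rintro ⟨h, ha⟩
    exact ⟨fun i => (h i).2, fun i => (h i).1, fun i => (h i).2.trans_le hβ, ha⟩
  · rintro ⟨hb, h0, -, ha⟩
    exact ⟨fun i => ⟨h0 i, hb i⟩, ha⟩

/-- For `β ≤ 1` the simplex of side `β` lies in the standard open ordered simplex. [folklore] -/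
theorem simplex_subset {β : ℝ} (hβ : β ≤ 1) (n : ℕ) :
    {t : Fin n → ℝ | (∀ i, 0 < t i ∧ t i < β) ∧ StrictAnti t} ⊆ KZ.openOrderedSimplex n := by
  rw [simplex_eq_inter hβ]
  exact inter_subset_right

/-- The simplex of side `β ≤ 1` is open, hence Lebesgue measurable. [folklore] -/
theorem measurableSet_simplex {β : ℝ} (hβ : β ≤ 1) (n : ℕ) :
    MeasurableSet {t : Fin n → ℝ | (∀ i, 0 < t i ∧ t i < β) ∧ StrictAnti t} := by
  rw [simplex_eq_inter hβ, Set.setOf_forall]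
  exact ((isOpen_iInter_of_finite fun i => isOpen_lt (continuous_apply i) continuous_const).inter
    (KZ.isOpen_openOrderedSimplex n)).measurableSet

/-- **The simplex of rational side `β ≤ 1` is `ℚ`-semialgebraic**: the finite intersection of the
strict polynomial inequalities `tᵢ < β` over `ℚ` with the `ℚ`-semialgebraic standard open ordered
simplex (`KZ.isSemialgebraic_openOrderedSimplex`). [cite: KontsevichZagier2001, §1.1] -/
theorem isSemialgebraic_simplex {β : ℝ} (hβ : β ≤ 1) (hq : ∃ q : ℚ, β = q) (n : ℕ) :
    IsSemialgebraic ℚ {t : Fin n → ℝ | (∀ i, 0 < t i ∧ t i < β) ∧ StrictAnti t} := by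
  obtain ⟨q, rfl⟩ := hq
  have h : {t : Fin n → ℝ | ∀ i, t i < q} = ⋂ i ∈ (Finset.univ : Finset (Fin n)),
      {t | aeval t (X i : MvPolynomial (Fin n) ℚ) < aeval t (C q : MvPolynomial (Fin n) ℚ)} := by
    ext t
    simp
  rw [simplex_eq_inter hβ, h]
  exact (IsSemialgebraic.biInter _ _ fun i _ => isSemialgebraic_setOf_eval_lt _ _).inter
    (KZ.isSemialgebraic_openOrderedSimplex n)

/-! ### The integrands `∏ᵢ 1/(tᵢ - sᵢ)` -/

/-- The integrand `∏ᵢ 1/(tᵢ - sᵢ)` is a measurable function on `ℝⁿ`. [folklore] -/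
theorem measurable_prodInv {n : ℕ} (s : Fin n → ℝ) :
    Measurable fun t : Fin n → ℝ => ∏ i, 1 / (t i - s i) :=
  Finset.measurable_prod _ fun i _ =>
    measurable_const.div ((measurable_pi_apply i).sub measurable_const)

/-- For rational poles the integrand is the quotient `1 / ∏ᵢ (Xᵢ - sᵢ)` of polynomials over `ℚ`
(an identity on all of `ℝⁿ`, junk value `1/0 = 0` on both sides).
[cite: KontsevichZagier2001, §1.1] -/
theorem prodInv_eq_aeval_div_aeval {n : ℕ} (sq : Fin n → ℚ) (t : Fin n → ℝ) :
    ∏ i, 1 / (t i - (sq i : ℝ)) = aeval t (1 : MvPolynomial (Fin n) ℚ) /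
      aeval t (∏ i : Fin n, (X i - C (sq i) : MvPolynomial (Fin n) ℚ)) := by
  simp only [map_one, map_prod, map_sub, aeval_X, aeval_C, eq_ratCast, one_div,
    ← Finset.prod_inv_distrib]

/-- **The integrand is a `ℚ`-semialgebraic function** on any `ℚ`-semialgebraic set missing its
(rational) poles: a quotient of polynomials over `ℚ` with non-vanishing denominator
(`isSemialgebraicFunOn_aeval_div_aeval`). [cite: KontsevichZagier2001, §1.1] -/
theorem isSemialgebraicFunOn_prodInv {n : ℕ} {D : Set (Fin n → ℝ)} (hD : IsSemialgebraic ℚ D)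
    (s : Fin n → ℝ) (hsq : ∀ i, ∃ q : ℚ, s i = q) (hne : ∀ t ∈ D, ∀ i, t i - s i ≠ 0) :
    IsSemialgebraicFunOn ℚ D (fun t => ∏ i, 1 / (t i - s i)) := by
  choose sq hsq using hsq
  have hs : s = fun i => ((sq i : ℚ) : ℝ) := funext hsq
  subst hs
  refine (isSemialgebraicFunOn_aeval_div_aeval hD 1 _ fun t ht => ?_).congr fun t _ =>
    (prodInv_eq_aeval_div_aeval sq t).symm
  rw [map_prod]
  refine Finset.prod_ne_zero_iff.mpr fun i _ => ?_
  rw [map_sub, aeval_X, aeval_C, eq_ratCast]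
  exact hne t ht i

/-! ### Absolute convergence -/

/-- **Product bound on the simplex**: if every pole is `0` or separated from `(0, β)`, then
`‖∏ᵢ 1/(tᵢ - sᵢ)‖ ≤ 2ⁿ ∏_{sᵢ = 0} tᵢ⁻¹` on the simplex of side `β`. [folklore] -/
theorem norm_prodInv_le {β : ℝ} {n : ℕ} (s : Fin n → ℝ)
    (hs : ∀ i, s i = 0 ∨ ∀ x : ℝ, 0 < x → x < β → 2⁻¹ ≤ |x - s i|) {t : Fin n → ℝ}
    (ht : t ∈ {t : Fin n → ℝ | (∀ i, 0 < t i ∧ t i < β) ∧ StrictAnti t}) :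
    ‖∏ i, 1 / (t i - s i)‖ ≤ 2 ^ n * ∏ i ∈ Finset.univ.filter (fun i => s i = 0), (t i)⁻¹ := by
  rw [Real.norm_eq_abs, Finset.abs_prod, Finset.prod_filter]
  calc ∏ i, |1 / (t i - s i)| ≤ ∏ i, 2 * (if s i = 0 then (t i)⁻¹ else 1) :=
        Finset.prod_le_prod (fun i _ => abs_nonneg _)
          fun i _ => abs_inv_sub_pole_le (hs i) (ht.1 i).1 (ht.1 i).2
    _ = 2 ^ n * ∏ i, (if s i = 0 then (t i)⁻¹ else 1) := by
        rw [Finset.prod_mul_distrib, Finset.prod_const, Finset.card_univ, Fintype.card_fin]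

/-- **Domination lemma** (the argument of `KZ.integrableOn_prod_mzvForm` on the simplex of side
`β ≤ 1`): a measurable function on `β > t₀ > ⋯ > t_k > 0` bounded by `C ∏_{i ∈ Z} tᵢ⁻¹` with
`k ∉ Z` is absolutely integrable — `t_k` is the smallest coordinate, so `KZ.prod_inv_le_prod_rpow`
dominates by `C ∏ᵢ tᵢ^{-c}`, `c = k/(k+1) < 1`, a product of one-variable functions integrable on
`(0, 1)` (Fubini on the cube). [cite: Zagier1994, §9] -/
theorem integrableOn_simplex_of_norm_le {β : ℝ} (hβ : β ≤ 1) {k : ℕ} (F : (Fin (k + 1) → ℝ) → ℝ)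
    (hF : AEStronglyMeasurable F
      (volume.restrict {t : Fin (k + 1) → ℝ | (∀ i, 0 < t i ∧ t i < β) ∧ StrictAnti t}))
    {C : ℝ} (hC : 0 ≤ C) (Z : Finset (Fin (k + 1))) (hZ : Fin.last k ∉ Z)
    (hle : ∀ t ∈ {t : Fin (k + 1) → ℝ | (∀ i, 0 < t i ∧ t i < β) ∧ StrictAnti t},
      ‖F t‖ ≤ C * ∏ i ∈ Z, (t i)⁻¹) :
    IntegrableOn F {t : Fin (k + 1) → ℝ | (∀ i, 0 < t i ∧ t i < β) ∧ StrictAnti t} volume := by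
  -- the exponent `c = k / (k + 1) = 1 - 1/(k+1)`
  set c : ℝ := k / (k + 1) with hc_def
  have hk : (0 : ℝ) < k + 1 := by positivity
  have hc0 : 0 ≤ c := by positivity
  have hc1 : c < 1 := by rw [hc_def, div_lt_one hk]; linarith
  have h1c : 1 - c = 1 / (k + 1) := by rw [hc_def, one_sub_div hk.ne']; ring
  have hcard : (Z.card : ℝ) * (1 - c) ≤ c := by
    have hS : Z ≠ Finset.univ := fun h => hZ (h ▸ Finset.mem_univ _)
    have hlt : Z.card < k + 1 := by
      simpa using Finset.card_lt_card (Finset.ssubset_univ_iff.mpr hS)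
    have hle' : (Z.card : ℝ) ≤ k := by exact_mod_cast Nat.lt_succ_iff.mp hlt
    calc (Z.card : ℝ) * (1 - c) ≤ k * (1 - c) := mul_le_mul_of_nonneg_right hle' (by linarith)
      _ = c := by rw [h1c, hc_def]; ring
  -- the dominating function: a constant times a product of one-variable integrable functions
  have hφ : Integrable ((Ioo (0 : ℝ) 1).indicator fun x : ℝ => x ^ (-c)) volume :=
    ((intervalIntegral.integrableOn_Ioo_rpow_iff zero_lt_one).2 (by linarith)).integrable_indicator
      measurableSet_Ioo
  have hg : Integrable (fun t : Fin (k + 1) → ℝ =>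
      C * ∏ i, (Ioo (0 : ℝ) 1).indicator (fun x : ℝ => x ^ (-c)) (t i))
      (volume : Measure (Fin (k + 1) → ℝ)) :=
    (Integrable.fintype_prod (μ := fun _ : Fin (k + 1) => (volume : Measure ℝ))
      (f := fun _ => (Ioo (0 : ℝ) 1).indicator fun x : ℝ => x ^ (-c)) fun _ => hφ).const_mul C
  refine Integrable.mono' hg.integrableOn hF
    ((ae_restrict_mem (measurableSet_simplex hβ _)).mono fun t ht => ?_)
  have hle_t := hle t ht
  obtain ⟨ht0, ht1, hanti⟩ := simplex_subset hβ _ ht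
  have hZ' : ∏ i ∈ Z, (t i)⁻¹ ≤ ∏ i, t i ^ (-c) :=
    KZ.prod_inv_le_prod_rpow Z t (Fin.last k) hZ ht0 (fun i => (ht1 i).le)
      (fun i => hanti.antitone (Fin.le_last i)) hc0 hc1.le hcard
  calc ‖F t‖ ≤ C * ∏ i ∈ Z, (t i)⁻¹ := hle_t
    _ ≤ C * ∏ i, t i ^ (-c) := mul_le_mul_of_nonneg_left hZ' hC
    _ = C * ∏ i, (Ioo (0 : ℝ) 1).indicator (fun x : ℝ => x ^ (-c)) (t i) := by
        congr 1
        exact Finset.prod_congr rfl fun i _ =>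
          (Set.indicator_of_mem (Set.mem_Ioo.2 ⟨ht0 i, ht1 i⟩) fun x : ℝ => x ^ (-c)).symm

/-- **Absolute convergence**: if every pole is `0` or separated from `(0, β)` (`β ≤ 1`) and the
innermost pole is not `0`, the integrand `∏ᵢ 1/(tᵢ - sᵢ)` is absolutely integrable on
`β > t₀ > ⋯ > t_{n-1} > 0` (`n = 0`: a constant on a point). [cite: KontsevichZagier2001, §1.1] -/
theorem integrableOn_prodInv {β : ℝ} (hβ : β ≤ 1) {n : ℕ} (s : Fin n → ℝ)
    (hs : ∀ i, s i = 0 ∨ ∀ x : ℝ, 0 < x → x < β → 2⁻¹ ≤ |x - s i|)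
    (hlast : ∀ h : 0 < n, s ⟨n - 1, Nat.sub_one_lt_of_lt h⟩ ≠ 0) :
    IntegrableOn (fun t : Fin n → ℝ => ∏ i, 1 / (t i - s i))
      {t : Fin n → ℝ | (∀ i, 0 < t i ∧ t i < β) ∧ StrictAnti t} volume := by
  rcases Nat.eq_zero_or_pos n with rfl | hn
  · have : IsFiniteMeasure (volume : Measure (Fin 0 → ℝ)) := by
      rw [volume_pi, Measure.pi_of_empty]; infer_instance
    simp only [Finset.univ_eq_empty, Finset.prod_empty]
    exact integrableOn_const
  obtain ⟨k, rfl⟩ : ∃ k, n = k + 1 := ⟨n - 1, by omega⟩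
  refine integrableOn_simplex_of_norm_le hβ _ (measurable_prodInv s).aestronglyMeasurable
    (by positivity) (Finset.univ.filter fun i => s i = 0) ?_ fun t ht => norm_prodInv_le s hs ht
  have : s (Fin.last k) ≠ 0 := by
    convert hlast hn using 2
    exact Fin.ext (by simp)
  simpa using this

/-! ### The representations -/

/-- **The representation of a path at the word `w`** exists, for any rational side `β ≤ 1` and
any row `σ : Fin 3 → ℝ` of rational poles with `σ j ≠ 0` for `j ≠ 0` and every pole `0` or
separated from `(0, β)`: domain the open ordered simplex of side `β`, integrand
`∏ᵢ 1/(tᵢ - σ(wᵢ))` if `w` does not end in the letter `0` (absolutely convergent case; the junk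
integrand `0` otherwise). [cite: KontsevichZagier2001, §1.1] -/
theorem exists_rep (β : ℝ) (σ : Fin 3 → ℝ) (hβq : ∃ q : ℚ, β = q) (hβ1 : β ≤ 1)
    (hσq : ∀ j, ∃ q : ℚ, σ j = q) (hσ0 : ∀ j, j ≠ 0 → σ j ≠ 0)
    (hsep : ∀ j, σ j = 0 ∨ ∀ x : ℝ, 0 < x → x < β → 2⁻¹ ≤ |x - σ j|) (w : List (Fin 3)) :
    ∃ r : KZ.IntegralRep w.length,
      r.domain = {t : Fin w.length → ℝ | (∀ i, 0 < t i ∧ t i < β) ∧ StrictAnti t} ∧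
      (w.getLast? ≠ some 0 → r.integrand = fun t => ∏ i, 1 / (t i - σ (w.get i))) := by
  have hdom : IsSemialgebraic ℚ {t : Fin w.length → ℝ | (∀ i, 0 < t i ∧ t i < β) ∧ StrictAnti t} :=
    isSemialgebraic_simplex hβ1 hβq _
  by_cases hw : w.getLast? ≠ some 0
  · refine ⟨⟨{t : Fin w.length → ℝ | (∀ i, 0 < t i ∧ t i < β) ∧ StrictAnti t},
      fun t => ∏ i, 1 / (t i - σ (w.get i)), hdom, ?_, ?_⟩, rfl, fun _ => rfl⟩
    · exact isSemialgebraicFunOn_prodInv hdom (fun i => σ (w.get i)) (fun i => hσq _)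
        fun t ht i => sub_pole_ne_zero (hsep (w.get i)) (ht.1 i).1 (ht.1 i).2
    · refine integrableOn_prodInv hβ1 (fun i => σ (w.get i)) (fun i => hsep (w.get i))
        fun hn => hσ0 _ fun h0 => hw ?_
      rw [List.getLast?_eq_getElem?, List.getElem?_eq_getElem (by omega)]
      simpa [List.get_eq_getElem] using h0
  · refine ⟨⟨{t : Fin w.length → ℝ | (∀ i, 0 < t i ∧ t i < β) ∧ StrictAnti t}, 0, hdom, ?_,
      integrableOn_zero⟩, rfl, fun h => absurd h hw⟩
    exact (isSemialgebraicFunOn_aeval hdom 0).congr fun t _ => by simp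

end PathFamilies

/-- **Stub `stub_pathFamilies`** [M]: the fifteen path families of absolutely convergent rational
iterated integrals exist as KZ representations (ℚ-semialgebraic open simplex `bound p > t₀ > ⋯ >
t_{n-1} > 0`, integrand `∏ᵢ 1/(tᵢ - s_p(wᵢ))`, absolutely integrable since the innermost letter is
not the pole at `0`). [folklore] -/
theorem stub_pathFamilies :
    ∃ I : (p : Fin 15) → (w : List (Fin 3)) → KZ.IntegralRep w.length, ∀ (p : Fin 15) (w : List (Fin 3)), w.getLast? ≠ some 0 → (I p w).domain = {t | (∀ i, 0 < t i ∧ t i < (![1/2, 1/2, 1/2, 1/2, 1/2, 1/2, 1/2, 1/2, 1/2, 1/2, 1, 1, 1/2, 1/2, 1/2] : Fin 15 → ℝ) p) ∧ StrictAnti t} ∧ Set.EqOn (I p w).integrand (fun t => ∏ i, 1 / (t i - (![![0, 1, 2], ![0, 1, -1], ![0, 1, 2], ![0, 1, -1], ![0, 1, 2], ![0, 1, 2], ![0, 1, 2], ![0, 1, 2], ![0, 1, 2], ![0, 1, 2], ![0, -1, 2], ![0, -1, 2], ![0, 1, 2], ![0, 1, 2], ![0, 1, 2]] : Fin 15 →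 Fin 3 → ℝ) p (w.get i))) (I p w).domain := by
  choose I hdom hint using fun (p : Fin 15) (w : List (Fin 3)) =>
    PathFamilies.exists_rep _ _ (PathFamilies.bound_rat p) (PathFamilies.bound_le_one p)
      (PathFamilies.shift_rat p) (PathFamilies.shift_ne_zero p) (PathFamilies.shift_sep p) w
  exact ⟨I, fun p w hw => ⟨hdom p w, fun t _ => by rw [hint p w hw]⟩⟩

end Summit.KontsevichZagierPeriods.FurushoPentagon.PentagonInKZ
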